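import Summits.QuantumFields.QCD.Theorems.SmallFieldUltracontractivity.Negative.Tightness
import Summits.QuantumFields.QCD.Theorems.HeatSlicedQuarksDaviesGaffneyWilsonRange

/-!
# The hopping perturbation `E = D_W(U) − D_W(1)` (helper for the caloric bootstrap of line
`point-centred-axial-parabolic`, crux `SmallFieldUltracontractivity`, item stmt-QuantumFields-8871)

For an `SU(3)` lattice gauge field `U` on the four-torus and the tree's `r = 1` Wilson–Dirac matrix,
the difference `E := wilsonDirac ρ U m 1 − wilsonDirac ρ 1 m 1` (mass-independent) is a pure
nearest-neighbour hopping matrix whose colour blocks are `ρ(U(z,μ)) − 1` and `ρ(U(z−μ̂,μ))⁻¹ − 1`: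

* `hopping_apply` — the entry formula;
* `hopping_apply_eq_zero` — `E_{pq} = 0` unless `torusDist p.1 q.1 ≤ 1`;
* `norm_sub_one_apply_le_of_deficit` — for `V ∈ SU(3)`: `|(ρV − 1)_{ab}|² ≤ 2(3 − Re tr ρV)`, and the
  same for `V⁻¹`;
* `sum_norm_hopping_row_le`, `sum_norm_hopping_col_le` — if every link based within `torusDist ≤ R`
  of a centre `x` has deficit `≤ λ²/2`, then the rows and columns of `|E|` indexed by sites with
  `torusDist x · + 1 ≤ R` sum to at most `96 λ`.

Pure bookkeeping over the definition of `wilsonDirac`; no named facts.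
-/

noncomputable section

namespace Summit.QuantumFields.QCD.Cruxes.SmallFieldUltracontractivity.PointCentredAxialParabolic

open Literature.MathematicalPhysics.QuantumLattice Literature.MathematicalPhysics.QuantumFieldTheory
open Literature.Probability.LatticeModels (TorusSite)
open Summit.QuantumFields.QCD.Theorems.SmallFieldUltracontractivity.Negative
open Summit.QuantumFields.QCD.Theorems.HeatSlicedQuarksDaviesGaffney
open scoped Matrix ComplexConjugate

variable {L : ℕ}

/-- Unitarity of the fundamental representation of `SU(3)`. -/
theorem fundamentalRep_unitary : ∀ g : SU3, fundamentalRep (Fin 3) g ∈ Matrix.unitaryGroup (Fin 3) ℂ :=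
  fundamentalRep_mem_unitaryGroup

/-- **Entry formula of the hopping perturbation.**  `(D_W(U) − D_W(1))_{pq} =
−½ Σ_μ ([q.1 = p.1+μ̂] (1−γ_μ)_{αβ} (ρU(p.1,μ) − 1)_{ab} + [p.1 = q.1+μ̂] (1+γ_μ)_{αβ} (ρU(q.1,μ)⁻¹ − 1)_{ab})`. -/
theorem hopping_apply (U : GaugeConfig 4 L SU3) (m : ℝ) (p q : TorusSite 4 L × Fin 3 × Fin 4) :
    (wilsonDirac (fundamentalRep (Fin 3)) U m 1 - wilsonDirac (fundamentalRep (Fin 3)) (freeCfg L) m 1) p q =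
      -(1 / 2 : ℂ) * ∑ μ : Fin 4,
        ((if q.1 = Site.shift p.1 μ then
            (((1 : ℝ) : ℂ) • (1 : Matrix (Fin 4) (Fin 4) ℂ) - euclideanGamma μ) p.2.2 q.2.2 *
              (fundamentalRep (Fin 3) (U (p.1, μ)) - 1) p.2.1 q.2.1 else 0) +
          (if p.1 = Site.shift q.1 μ then
            (((1 : ℝ) : ℂ) • (1 : Matrix (Fin 4) (Fin 4) ℂ) + euclideanGamma μ) p.2.2 q.2.2 *
              (fundamentalRep (Fin 3) (U (q.1, μ))⁻¹ - 1) p.2.1 q.2.1 else 0)) := by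
  simp only [Matrix.sub_apply, wilsonDirac, Matrix.of_apply, freeCfg, map_one, inv_one]
  rw [sub_sub_sub_cancel_left, ← mul_sub, ← Finset.sum_sub_distrib, neg_mul, ← mul_neg,
    ← Finset.sum_neg_distrib]
  congr 1
  refine Finset.sum_congr rfl fun μ _ => ?_
  split_ifs <;> ring

/-- **Finite range.**  The hopping perturbation couples only sites at torus distance `≤ 1`. -/
theorem hopping_apply_eq_zero [NeZero L] (U : GaugeConfig 4 L SU3) (m : ℝ)
    (p q : TorusSite 4 L × Fin 3 × Fin 4) (hpq : 1 < torusDist p.1 q.1) :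
    (wilsonDirac (fundamentalRep (Fin 3)) U m 1 - wilsonDirac (fundamentalRep (Fin 3)) (freeCfg L) m 1) p q = 0 := by
  rw [Matrix.sub_apply, wilsonDirac_apply_eq_zero _ U m 1 p q hpq,
    wilsonDirac_apply_eq_zero _ (freeCfg L) m 1 p q hpq, sub_zero]

/-- For a unitary `3 × 3` matrix `V`: `Σ_{a,b} |(V − 1)_{ab}|² = 2 (3 − Re tr V)`. -/
theorem sum_norm_sq_sub_one_eq (V : Matrix (Fin 3) (Fin 3) ℂ) (hV : V ∈ Matrix.unitaryGroup (Fin 3) ℂ) :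
    ∑ a, ∑ b, ‖(V - 1) a b‖ ^ 2 = 2 * (3 - V.trace.re) := by
  -- `Σ_{ab} |(V-1)_{ab}|² = Re tr ((V-1)ᴴ (V-1)) = Re tr (2·1 − V − Vᴴ) = 6 − 2 Re tr V`
  have hU : Vᴴ * V = 1 := Matrix.mem_unitaryGroup_iff'.mp hV
  have key : ∀ a b, (‖(V - 1) a b‖ ^ 2 : ℝ) = (star ((V - 1) a b) * (V - 1) a b).re := by
    intro a b
    rw [Complex.star_def, Complex.conj_mul', ← Complex.ofReal_pow, Complex.ofReal_re]
  simp_rw [key]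
  rw [show (∑ a, ∑ b, (star ((V - 1) a b) * (V - 1) a b).re) = (((V - 1)ᴴ * (V - 1)).trace).re by
    rw [Matrix.trace, Complex.re_sum, Finset.sum_comm]
    refine Finset.sum_congr rfl fun b _ => ?_
    rw [Matrix.diag_apply, Matrix.mul_apply, Complex.re_sum]
    refine Finset.sum_congr rfl fun a _ => ?_
    rw [Matrix.conjTranspose_apply]]
  rw [Matrix.conjTranspose_sub, Matrix.conjTranspose_one, Matrix.sub_mul, Matrix.mul_sub,
    Matrix.mul_sub, hU, Matrix.one_mul, Matrix.one_mul, Matrix.mul_one]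
  simp only [Matrix.trace_sub, Matrix.trace_one, Complex.sub_re, Fintype.card_fin]
  have htr : (Vᴴ).trace.re = V.trace.re := by
    rw [Matrix.trace_conjTranspose, Complex.star_def, Complex.conj_re]
  rw [htr]
  norm_num
  ring

/-- **Link smallness from the deficit.**  For `V ∈ SU(3)` every entry of `ρV − 1` is bounded by
`√(2·(3 − Re tr ρV))`; in squared form: `|(ρV − 1)_{ab}|² ≤ 2 (3 − Re tr ρV)`. -/
theorem norm_sq_sub_one_apply_le_deficit (V : SU3) (a b : Fin 3) :
    ‖(fundamentalRep (Fin 3) V - 1) a b‖ ^ 2 ≤ 2 * (3 - (fundamentalRep (Fin 3) V).trace.re) := by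
  rw [← sum_norm_sq_sub_one_eq _ (fundamentalRep_unitary V)]
  calc ‖(fundamentalRep (Fin 3) V - 1) a b‖ ^ 2
      ≤ ∑ b', ‖(fundamentalRep (Fin 3) V - 1) a b'‖ ^ 2 :=
        Finset.single_le_sum (f := fun b' => ‖(fundamentalRep (Fin 3) V - 1) a b'‖ ^ 2)
          (fun _ _ => by positivity) (Finset.mem_univ b)
    _ ≤ ∑ a', ∑ b', ‖(fundamentalRep (Fin 3) V - 1) a' b'‖ ^ 2 :=
        Finset.single_le_sum (f := fun a' => ∑ b', ‖(fundamentalRep (Fin 3) V - 1) a' b'‖ ^ 2)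
          (fun _ _ => by positivity) (Finset.mem_univ a)

/-- The inverse link has the same deficit bound: `|(ρ(V⁻¹) − 1)_{ab}|² ≤ 2 (3 − Re tr ρV)`
(`ρ(V⁻¹) = (ρV)ᴴ` for the unitary representation `ρ`). -/
theorem norm_sq_inv_sub_one_apply_le_deficit (V : SU3) (a b : Fin 3) :
    ‖(fundamentalRep (Fin 3) V⁻¹ - 1) a b‖ ^ 2 ≤ 2 * (3 - (fundamentalRep (Fin 3) V).trace.re) := by
  have hinv : fundamentalRep (Fin 3) V⁻¹ = (fundamentalRep (Fin 3) V)ᴴ := by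
    rw [← star_rep_eq_rep_inv _ fundamentalRep_unitary V, Matrix.star_eq_conjTranspose]
  have hentry : (fundamentalRep (Fin 3) V⁻¹ - 1) a b = star ((fundamentalRep (Fin 3) V - 1) b a) := by
    rw [hinv, Matrix.sub_apply, Matrix.sub_apply, Matrix.conjTranspose_apply, star_sub,
      Matrix.one_apply, Matrix.one_apply]
    by_cases h : a = b
    · subst h; simp
    · rw [if_neg h, if_neg (Ne.symm h), star_zero]
  rw [hentry, norm_star]
  exact norm_sq_sub_one_apply_le_deficit V b a

/-- From a deficit bound `3 − Re tr ρV ≤ λ²/2` (`λ ≥ 0`) to entry bounds `|(ρV − 1)_{ab}| ≤ λ` and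
`|(ρ(V⁻¹) − 1)_{ab}| ≤ λ`. -/
theorem norm_sub_one_apply_le_of_deficit (V : SU3) {lam : ℝ} (hlam : 0 ≤ lam)
    (hV : 3 - (fundamentalRep (Fin 3) V).trace.re ≤ lam ^ 2 / 2) (a b : Fin 3) :
    ‖(fundamentalRep (Fin 3) V - 1) a b‖ ≤ lam ∧ ‖(fundamentalRep (Fin 3) V⁻¹ - 1) a b‖ ≤ lam := by
  have h2 : 2 * (3 - (fundamentalRep (Fin 3) V).trace.re) ≤ lam ^ 2 := by linarith
  constructor
  · exact (sq_le_sq₀ (norm_nonneg _) hlam).mp ((norm_sq_sub_one_apply_le_deficit V a b).trans h2)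
  · exact (sq_le_sq₀ (norm_nonneg _) hlam).mp ((norm_sq_inv_sub_one_apply_le_deficit V a b).trans h2)

/-- Entries of `1 ∓ γ_μ` have modulus at most `2`. -/
theorem norm_one_sub_gamma_apply_le_two (μ : Fin 4) (α β : Fin 4) :
    ‖(((1 : ℝ) : ℂ) • (1 : Matrix (Fin 4) (Fin 4) ℂ) - euclideanGamma μ) α β‖ ≤ 2 := by
  have h := norm_smul_one_sub_gamma_apply_le 1 μ α β
  have h2 : |(1 : ℝ)| + 1 = 2 := by norm_num
  rw [h2] at h
  exact h

/-- Entries of `1 + γ_μ` have modulus at most `2`. -/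
theorem norm_one_add_gamma_apply_le_two (μ : Fin 4) (α β : Fin 4) :
    ‖(((1 : ℝ) : ℂ) • (1 : Matrix (Fin 4) (Fin 4) ℂ) + euclideanGamma μ) α β‖ ≤ 2 := by
  have h := norm_smul_one_add_gamma_apply_le 1 μ α β
  have h2 : |(1 : ℝ)| + 1 = 2 := by norm_num
  rw [h2] at h
  exact h

variable [NeZero L]

omit [NeZero L] in
/-- **Entrywise bound of the hopping perturbation** in terms of a uniform entry bound `λ` on the
colour blocks of the links involved:
`|E_{pq}| ≤ ½ Σ_μ (2λ·[q.1 = p.1+μ̂] + 2λ·[p.1 = q.1+μ̂])`, valid whenever the forward links at `p.1`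
and the links ending at `p.1` are `λ`-close to `1` entrywise. -/
theorem norm_hopping_apply_le (U : GaugeConfig 4 L SU3) (m : ℝ) (p q : TorusSite 4 L × Fin 3 × Fin 4)
    {lam : ℝ}
    (hfwd : ∀ μ : Fin 4, q.1 = Site.shift p.1 μ → ∀ a b, ‖(fundamentalRep (Fin 3) (U (p.1, μ)) - 1) a b‖ ≤ lam)
    (hbwd : ∀ μ : Fin 4, p.1 = Site.shift q.1 μ → ∀ a b, ‖(fundamentalRep (Fin 3) (U (q.1, μ))⁻¹ - 1) a b‖ ≤ lam) :
    ‖(wilsonDirac (fundamentalRep (Fin 3)) U m 1 - wilsonDirac (fundamentalRep (Fin 3)) (freeCfg L) m 1) p q‖ ≤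
      (1 / 2) * ∑ μ : Fin 4, ((if q.1 = Site.shift p.1 μ then 2 * lam else 0) +
        (if p.1 = Site.shift q.1 μ then 2 * lam else 0)) := by
  rw [hopping_apply, norm_mul, norm_neg]
  have h12 : ‖(1 / 2 : ℂ)‖ = 1 / 2 := by simp
  rw [h12]
  refine mul_le_mul_of_nonneg_left ((norm_sum_le _ _).trans (Finset.sum_le_sum fun μ _ => ?_))
    (by norm_num)
  refine (norm_add_le _ _).trans (add_le_add ?_ ?_)
  · split_ifs with h
    · rw [norm_mul]
      calc _ ≤ 2 * lam := mul_le_mul (norm_one_sub_gamma_apply_le_two μ _ _) (hfwd μ h _ _)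
            (norm_nonneg _) (by norm_num)
        _ = 2 * lam := rfl
    · simp
  · split_ifs with h
    · rw [norm_mul]
      exact mul_le_mul (norm_one_add_gamma_apply_le_two μ _ _) (hbwd μ h _ _) (norm_nonneg _)
        (by norm_num)
    · simp

/-- Counting over the colour–spin fibre: `Σ_{q} [q.1 = s]·c = 12·c`. -/
theorem sum_ite_fst_eq_twelve (s : TorusSite 4 L) (c : ℝ) :
    ∑ q : TorusSite 4 L × Fin 3 × Fin 4, (if q.1 = s then c else 0) = 12 * c := by
  rw [sum_ite_fst_eq]; norm_num

/-- **Row sums of `|E|` near a flat centre.**  If every link based within `torusDist ≤ R` of `x`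
has deficit `≤ λ²/2`, then for every index `p` with `torusDist x p.1 + 1 ≤ R`:
`Σ_q |E_{pq}| ≤ 96 λ`. -/
theorem sum_norm_hopping_row_le (U : GaugeConfig 4 L SU3) (m : ℝ) (x : TorusSite 4 L) (R : ℕ)
    {lam : ℝ} (hlam : 0 ≤ lam)
    (hflat : ∀ z : TorusSite 4 L, torusDist x z ≤ R → ∀ μ : Fin 4,
      3 - ((fundamentalRep (Fin 3)) (U (z, μ))).trace.re ≤ lam ^ 2 / 2)
    (p : TorusSite 4 L × Fin 3 × Fin 4) (hp : torusDist x p.1 + 1 ≤ R) :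
    ∑ q, ‖(wilsonDirac (fundamentalRep (Fin 3)) U m 1 -
        wilsonDirac (fundamentalRep (Fin 3)) (freeCfg L) m 1) p q‖ ≤ 96 * lam := by
  have hfwd : ∀ μ : Fin 4, ∀ a b, ‖(fundamentalRep (Fin 3) (U (p.1, μ)) - 1) a b‖ ≤ lam :=
    fun μ a b => (norm_sub_one_apply_le_of_deficit _ hlam (hflat p.1 (by omega) μ) a b).1
  have hbwd : ∀ (q : TorusSite 4 L × Fin 3 × Fin 4) (μ : Fin 4), p.1 = Site.shift q.1 μ →
      ∀ a b, ‖(fundamentalRep (Fin 3) (U (q.1, μ))⁻¹ - 1) a b‖ ≤ lam := by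
    intro q μ h a b
    have hd : torusDist x q.1 ≤ R := by
      have h1 : torusDist p.1 q.1 ≤ 1 := by rw [h]; exact torusDist_shift_self_le q.1 μ
      have := torusDist_triangle' x p.1 q.1
      omega
    exact (norm_sub_one_apply_le_of_deficit _ hlam (hflat q.1 hd μ) a b).2
  calc ∑ q, ‖(wilsonDirac (fundamentalRep (Fin 3)) U m 1 -
          wilsonDirac (fundamentalRep (Fin 3)) (freeCfg L) m 1) p q‖
      ≤ ∑ q : TorusSite 4 L × Fin 3 × Fin 4, (1 / 2) * ∑ μ : Fin 4,
          ((if q.1 = Site.shift p.1 μ then 2 * lam else 0) + (if p.1 = Site.shift q.1 μ then 2 * lam else 0)) :=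
        Finset.sum_le_sum fun q _ => norm_hopping_apply_le U m p q (fun μ _ => hfwd μ) (hbwd q)
    _ = (1 / 2) * ∑ μ : Fin 4, ((∑ q : TorusSite 4 L × Fin 3 × Fin 4, if q.1 = Site.shift p.1 μ then 2 * lam else 0) +
          ∑ q : TorusSite 4 L × Fin 3 × Fin 4, if p.1 = Site.shift q.1 μ then 2 * lam else 0) := by
        rw [← Finset.mul_sum, Finset.sum_comm]
        simp only [Finset.sum_add_distrib]
    _ = (1 / 2) * ∑ μ : Fin 4, (12 * (2 * lam) + 12 * (2 * lam)) := by
        congr 1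
        refine Finset.sum_congr rfl fun μ _ => ?_
        rw [sum_ite_fst_eq_twelve]
        congr 1
        have : ∀ q : TorusSite 4 L × Fin 3 × Fin 4, (p.1 = Site.shift q.1 μ) = (q.1 = p.1 - Pi.single μ 1) :=
          fun q => propext (eq_shift_iff p.1 q.1 μ)
        simp_rw [this]
        exact sum_ite_fst_eq_twelve _ _
    _ = 96 * lam := by simp; ring

/-- **Column sums of `|E|` near a flat centre**: under the same hypothesis, for every index `q`
with `torusDist x q.1 + 1 ≤ R`: `Σ_p |E_{pq}| ≤ 96 λ`. -/
theorem sum_norm_hopping_col_le (U : GaugeConfig 4 L SU3) (m : ℝ) (x : TorusSite 4 L) (R : ℕ)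
    {lam : ℝ} (hlam : 0 ≤ lam)
    (hflat : ∀ z : TorusSite 4 L, torusDist x z ≤ R → ∀ μ : Fin 4,
      3 - ((fundamentalRep (Fin 3)) (U (z, μ))).trace.re ≤ lam ^ 2 / 2)
    (q : TorusSite 4 L × Fin 3 × Fin 4) (hq : torusDist x q.1 + 1 ≤ R) :
    ∑ p, ‖(wilsonDirac (fundamentalRep (Fin 3)) U m 1 -
        wilsonDirac (fundamentalRep (Fin 3)) (freeCfg L) m 1) p q‖ ≤ 96 * lam := by
  have hbwd : ∀ μ : Fin 4, ∀ a b, ‖(fundamentalRep (Fin 3) (U (q.1, μ))⁻¹ - 1) a b‖ ≤ lam :=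
    fun μ a b => (norm_sub_one_apply_le_of_deficit _ hlam (hflat q.1 (by omega) μ) a b).2
  have hfwd : ∀ (p : TorusSite 4 L × Fin 3 × Fin 4) (μ : Fin 4), q.1 = Site.shift p.1 μ →
      ∀ a b, ‖(fundamentalRep (Fin 3) (U (p.1, μ)) - 1) a b‖ ≤ lam := by
    intro p μ h a b
    have hd : torusDist x p.1 ≤ R := by
      have h1 : torusDist q.1 p.1 ≤ 1 := by rw [h]; exact torusDist_shift_self_le p.1 μ
      have := torusDist_triangle' x q.1 p.1
      omega
    exact (norm_sub_one_apply_le_of_deficit _ hlam (hflat p.1 hd μ) a b).1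
  calc ∑ p, ‖(wilsonDirac (fundamentalRep (Fin 3)) U m 1 -
          wilsonDirac (fundamentalRep (Fin 3)) (freeCfg L) m 1) p q‖
      ≤ ∑ p : TorusSite 4 L × Fin 3 × Fin 4, (1 / 2) * ∑ μ : Fin 4,
          ((if q.1 = Site.shift p.1 μ then 2 * lam else 0) + (if p.1 = Site.shift q.1 μ then 2 * lam else 0)) :=
        Finset.sum_le_sum fun p _ => norm_hopping_apply_le U m p q (hfwd p) (fun μ _ => hbwd μ)
    _ = (1 / 2) * ∑ μ : Fin 4, ((∑ p : TorusSite 4 L × Fin 3 × Fin 4, if q.1 = Site.shift p.1 μ then 2 * lam else 0) +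
          ∑ p : TorusSite 4 L × Fin 3 × Fin 4, if p.1 = Site.shift q.1 μ then 2 * lam else 0) := by
        rw [← Finset.mul_sum, Finset.sum_comm]
        simp only [Finset.sum_add_distrib]
    _ = (1 / 2) * ∑ μ : Fin 4, (12 * (2 * lam) + 12 * (2 * lam)) := by
        congr 1
        refine Finset.sum_congr rfl fun μ _ => ?_
        rw [sum_ite_fst_eq_twelve]
        congr 1
        have : ∀ p : TorusSite 4 L × Fin 3 × Fin 4, (q.1 = Site.shift p.1 μ) = (p.1 = q.1 - Pi.single μ 1) :=
          fun p => propext (eq_shift_iff q.1 p.1 μ)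
        simp_rw [this]
        exact sum_ite_fst_eq_twelve _ _
    _ = 96 * lam := by simp; ring

/-- **Registered form (stub `stub_hoppingRowSums` of the crux item): row AND column sums of the
hopping perturbation `E = D_W(U) − D_W(1)` near a flat centre are `≤ 96 λ`.**  If every link based
within `torusDist ≤ R` of `x` has deficit `≤ λ²/2` (`λ ≥ 0`), then for every index `p` with
`torusDist x p.1 + 1 ≤ R`, both `Σ_q |E_{pq}|` and `Σ_q |E_{qp}|` are at most `96 λ`. -/
theorem stub_hoppingRowSums :
    ∀ (L : ℕ) [NeZero L] (U : GaugeConfig 4 L SU3) (m : ℝ) (x : TorusSite 4 L) (R : ℕ) (lam : ℝ), 0 ≤ lam →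
      (∀ z : TorusSite 4 L, torusDist x z ≤ R → ∀ μ : Fin 4,
        3 - ((fundamentalRep (Fin 3)) (U (z, μ))).trace.re ≤ lam ^ 2 / 2) →
      ∀ p : TorusSite 4 L × Fin 3 × Fin 4, torusDist x p.1 + 1 ≤ R →
        (∑ q, ‖(wilsonDirac (fundamentalRep (Fin 3)) U m 1 -
            wilsonDirac (fundamentalRep (Fin 3)) (freeCfg L) m 1) p q‖ ≤ 96 * lam) ∧
        (∑ q, ‖(wilsonDirac (fundamentalRep (Fin 3)) U m 1 -
            wilsonDirac (fundamentalRep (Fin 3)) (freeCfg L) m 1) q p‖ ≤ 96 * lam) :=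
  fun _ _ U m x R _ hlam hflat p hp =>
    ⟨sum_norm_hopping_row_le U m x R hlam hflat p hp, sum_norm_hopping_col_le U m x R hlam hflat p hp⟩

end Summit.QuantumFields.QCD.Cruxes.SmallFieldUltracontractivity.PointCentredAxialParabolic

end
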